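import Summits.PneNP.PneNP.Theorems.ExpanderLinearGeneratorsColumnTwoExtract

/-!
# PneNP / ExpanderLinearGenerators — column weight two: expansion inside the dense core

Route `PneNP/ExpanderLinearGenerators`, support for crux stmt-PneNP-11443. Consequences of the
touching and stopping properties of the core `U` of `exists_dense_core` (level `i`), under local
sparsity (`8 e(W) ≤ Σ_W |S ·|` for `|W| ≤ r`), scopes of size `≤ ℓ` and rows of size `≥ 3ℓ/4`:

* `cut_small` — `W ⊆ U`, `|W| ≤ r` ⟹ `373 Σ_W |S ·| ≤ 1000 |cut U W|`;
* `nbr_small` — `W ⊆ U`, `3|W| ≤ r` ⟹ `186 |W| ≤ 125 |nbr U W|` (vertex expansion by `1.488`);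
* `cut_big` — `W ⊆ U`, `r < |W|`, `2|W| ≤ |U|` ⟹ `Σ_W |S ·| < 1000 (i+1)(i+2) |cut U W|`;
* `sum_le_cut`, `card_le_nbr` — uniformly for `2|W| ≤ |U|`: `Σ_W |S ·| ≤ 1000(i+1)(i+2) |cut U W|`
  and `3 |W| ≤ 4000 (i+1)(i+2) |nbr U W|`.

References: M. Krivelevich, SIAM J. Discrete Math. 32 (2018), proof of Theorem 1 [folklore].
-/

namespace Summit.PneNP.PneNP.Theorems.ColumnTwo

open Finset Literature.Computability.MetaComplexity

variable {ι : Type*} [Fintype ι] [DecidableEq ι] {S : ι → Finset ℕ}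

/-- The touching property in terms of the cut: `thetaNum i · Σ_W ≤ thetaDen i · (e(W) + |cut|)`.
[folklore] -/
theorem touch_cut (hcw : ∀ v, coverDegree S Finset.univ v ≤ 2) {U : Finset ι} {i : ℕ}
    (htouch : ∀ W ⊆ U, thetaNum i * ∑ k ∈ W, (S k).card ≤ thetaDen i * (eIn S U - eIn S (U \ W)))
    {W : Finset ι} (hW : W ⊆ U) :
    thetaNum i * ∑ k ∈ W, (S k).card ≤ thetaDen i * (eIn S W + (cut S U W).card) := by
  have h := htouch W hW
  have h2 := eIn_eq_add hcw hW
  rwa [show eIn S U - eIn S (U \ W) = eIn S W + (cut S U W).card by omega] at h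

/-- **Small sets have large cuts**: `W ⊆ U`, `|W| ≤ r` ⟹ `373 Σ_{k∈W} |S k| ≤ 1000 |cut U W|`.
[folklore] -/
theorem cut_small (hcw : ∀ v, coverDegree S Finset.univ v ≤ 2) {C₀ U : Finset ι} {r i : ℕ}
    (hLS : ∀ W ⊆ C₀, W.card ≤ r → 8 * eIn S W ≤ ∑ k ∈ W, (S k).card) (hUC : U ⊆ C₀)
    (htouch : ∀ W ⊆ U, thetaNum i * ∑ k ∈ W, (S k).card ≤ thetaDen i * (eIn S U - eIn S (U \ W)))
    {W : Finset ι} (hW : W ⊆ U) (hWr : W.card ≤ r) :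
    373 * ∑ k ∈ W, (S k).card ≤ 1000 * (cut S U W).card := by
  have h1 := touch_cut hcw htouch hW
  have h2 := hLS W (hW.trans hUC) hWr
  unfold thetaNum thetaDen at h1
  have h3 : (i + 1) * (373 * ∑ k ∈ W, (S k).card) ≤ (i + 1) * (1000 * (cut S U W).card) := by
    nlinarith
  exact Nat.le_of_mul_le_mul_left h3 (by omega)

/-- **Small sets have many neighbours**: `W ⊆ U`, `3|W| ≤ r` ⟹ `186 |W| ≤ 125 |nbr U W|` (rows of
`U` have `≥ 3ℓ/4` points, scopes have `≤ ℓ`). [folklore] -/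
theorem nbr_small (hcw : ∀ v, coverDegree S Finset.univ v ≤ 2) {C₀ U : Finset ι} {r i ℓ : ℕ}
    (hℓ : ∀ k, (S k).card ≤ ℓ) (hmin : ∀ k ∈ U, 3 * ℓ ≤ 4 * (S k).card) (hℓ0 : 0 < ℓ)
    (hLS : ∀ W ⊆ C₀, W.card ≤ r → 8 * eIn S W ≤ ∑ k ∈ W, (S k).card) (hUC : U ⊆ C₀)
    (htouch : ∀ W ⊆ U, thetaNum i * ∑ k ∈ W, (S k).card ≤ thetaDen i * (eIn S U - eIn S (U \ W)))
    {W : Finset ι} (hW : W ⊆ U) (h3 : 3 * W.card ≤ r) :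
    186 * W.card ≤ 125 * (nbr S U W).card := by
  set Y := nbr S U W with hY
  by_cases hbig : 2 * W.card ≤ Y.card
  · omega
  push Not at hbig
  have hYU : Y ⊆ U := (nbr_subset_sdiff U W).trans Finset.sdiff_subset
  have hWY : (W ∪ Y).card ≤ r := (Finset.card_union_le _ _).trans (by omega)
  have h1 := cut_small hcw hLS hUC htouch hW (by omega)
  have h2 : (cut S U W).card ≤ eIn S (W ∪ Y) := Finset.card_le_card (cut_subset_inner_union_nbr U W)
  have h3' := hLS (W ∪ Y) (Finset.union_subset (hW.trans hUC) (hYU.trans hUC)) hWY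
  have h4 : ∑ k ∈ W ∪ Y, (S k).card ≤ ∑ k ∈ W, (S k).card + ℓ * Y.card := by
    calc ∑ k ∈ W ∪ Y, (S k).card ≤ ∑ k ∈ W, (S k).card + ∑ k ∈ Y, (S k).card := by
          have := Finset.sum_union_inter (s₁ := W) (s₂ := Y) (f := fun k => (S k).card)
          omega
      _ ≤ ∑ k ∈ W, (S k).card + ∑ k ∈ Y, ℓ := by gcongr with k hk; exact hℓ k
      _ = _ := by rw [Finset.sum_const, smul_eq_mul, mul_comm]
  have h5 : 3 * ℓ * W.card ≤ 4 * ∑ k ∈ W, (S k).card := by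
    calc 3 * ℓ * W.card = ∑ k ∈ W, 3 * ℓ := by rw [Finset.sum_const, smul_eq_mul]; ring
      _ ≤ ∑ k ∈ W, 4 * (S k).card := Finset.sum_le_sum fun k hk => hmin k (hW hk)
      _ = _ := by rw [Finset.mul_sum]
  have h6 : ℓ * (186 * W.card) ≤ ℓ * (125 * Y.card) := by linarith
  exact Nat.le_of_mul_le_mul_left h6 hℓ0

/-- **Large sets have cuts at rate `1/(1000(i+1)(i+2))`**: `W ⊆ U`, `r < |W|`, `2|W| ≤ |U|` ⟹
`Σ_{k∈W} |S k| < 1000 (i+1)(i+2) |cut U W|`. [folklore] -/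
theorem cut_big (hcw : ∀ v, coverDegree S Finset.univ v ≤ 2) {U : Finset ι} {r i : ℕ}
    (htouch : ∀ W ⊆ U, thetaNum i * ∑ k ∈ W, (S k).card ≤ thetaDen i * (eIn S U - eIn S (U \ W)))
    (hstop : ∀ W ⊆ U, r < W.card → 2 * W.card ≤ U.card →
      thetaDen (i + 1) * eIn S W < thetaNum (i + 1) * ∑ k ∈ W, (S k).card)
    {W : Finset ι} (hW : W ⊆ U) (hrW : r < W.card) (h2W : 2 * W.card ≤ U.card) :
    ∑ k ∈ W, (S k).card < 1000 * (i + 1) * (i + 2) * (cut S U W).card := by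
  have ht := touch_cut hcw htouch hW
  have hs := hstop W hW hrW h2W
  have hid := thetaNum_succ_identity i
  unfold thetaDen at ht hs
  have ht' := Nat.mul_le_mul_left (i + 2) ht
  have hs' := Nat.mul_lt_mul_of_pos_left hs (show 0 < i + 1 by omega)
  have e1 : (i + 2) * (thetaNum i * ∑ k ∈ W, (S k).card) =
      thetaNum (i + 1) * (i + 1) * ∑ k ∈ W, (S k).card + ∑ k ∈ W, (S k).card := by
    calc (i + 2) * (thetaNum i * ∑ k ∈ W, (S k).card)
        = (thetaNum i * (i + 2)) * ∑ k ∈ W, (S k).card := by ring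
      _ = (thetaNum (i + 1) * (i + 1) + 1) * ∑ k ∈ W, (S k).card := by rw [hid]
      _ = _ := by ring
  rw [e1] at ht'
  generalize thetaNum (i + 1) = N at ht' hs'
  generalize ∑ k ∈ W, (S k).card = A at ht' hs' ⊢
  generalize eIn S W = E at ht' hs'
  generalize (cut S U W).card = C at ht' ⊢
  nlinarith

/-- **Cuts at all scales**: `W ⊆ U`, `2|W| ≤ |U|` ⟹ `Σ_{k ∈ W} |S k| ≤ 1000(i+1)(i+2) |cut U W|`.
[folklore] -/
theorem sum_le_cut (hcw : ∀ v, coverDegree S Finset.univ v ≤ 2) {C₀ U : Finset ι} {r i : ℕ}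
    (hLS : ∀ W ⊆ C₀, W.card ≤ r → 8 * eIn S W ≤ ∑ k ∈ W, (S k).card) (hUC : U ⊆ C₀)
    (htouch : ∀ W ⊆ U, thetaNum i * ∑ k ∈ W, (S k).card ≤ thetaDen i * (eIn S U - eIn S (U \ W)))
    (hstop : ∀ W ⊆ U, r < W.card → 2 * W.card ≤ U.card →
      thetaDen (i + 1) * eIn S W < thetaNum (i + 1) * ∑ k ∈ W, (S k).card)
    {W : Finset ι} (hW : W ⊆ U) (h2W : 2 * W.card ≤ U.card) :
    ∑ k ∈ W, (S k).card ≤ 1000 * (i + 1) * (i + 2) * (cut S U W).card := by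
  by_cases hWr : W.card ≤ r
  · have := cut_small hcw hLS hUC htouch hW hWr
    have h1 : 1000 ≤ 1000 * (i + 1) * (i + 2) := by nlinarith
    nlinarith
  · exact (cut_big hcw htouch hstop hW (by omega) h2W).le

/-- **Vertex expansion at all scales** (the core is a `3/(4000(i+1)(i+2))`-expander): `W ⊆ U`,
`2|W| ≤ |U|` ⟹ `3 |W| ≤ 4000 (i+1)(i+2) |nbr U W|`. [folklore] -/
theorem card_le_nbr (hcw : ∀ v, coverDegree S Finset.univ v ≤ 2) {C₀ U : Finset ι} {r i ℓ : ℕ}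
    (hℓ : ∀ k, (S k).card ≤ ℓ) (hmin : ∀ k ∈ U, 3 * ℓ ≤ 4 * (S k).card) (hℓ0 : 0 < ℓ)
    (hLS : ∀ W ⊆ C₀, W.card ≤ r → 8 * eIn S W ≤ ∑ k ∈ W, (S k).card) (hUC : U ⊆ C₀)
    (htouch : ∀ W ⊆ U, thetaNum i * ∑ k ∈ W, (S k).card ≤ thetaDen i * (eIn S U - eIn S (U \ W)))
    (hstop : ∀ W ⊆ U, r < W.card → 2 * W.card ≤ U.card →
      thetaDen (i + 1) * eIn S W < thetaNum (i + 1) * ∑ k ∈ W, (S k).card)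
    {W : Finset ι} (hW : W ⊆ U) (h2W : 2 * W.card ≤ U.card) :
    3 * W.card ≤ 4000 * (i + 1) * (i + 2) * (nbr S U W).card := by
  have h1 := sum_le_cut hcw hLS hUC htouch hstop hW h2W
  have h2 := card_cut_le hℓ U W
  have h5 : 3 * ℓ * W.card ≤ 4 * ∑ k ∈ W, (S k).card := by
    calc 3 * ℓ * W.card = ∑ k ∈ W, 3 * ℓ := by rw [Finset.sum_const, smul_eq_mul]; ring
      _ ≤ ∑ k ∈ W, 4 * (S k).card := Finset.sum_le_sum fun k hk => hmin k (hW hk)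
      _ = _ := by rw [Finset.mul_sum]
  have h3 : 1000 * (i + 1) * (i + 2) * (cut S U W).card ≤
      1000 * (i + 1) * (i + 2) * (ℓ * (nbr S U W).card) := Nat.mul_le_mul_left _ h2
  have h6 : ℓ * (3 * W.card) ≤ ℓ * (4000 * (i + 1) * (i + 2) * (nbr S U W).card) :=
    calc ℓ * (3 * W.card) = 3 * ℓ * W.card := by ring
      _ ≤ 4 * ∑ k ∈ W, (S k).card := h5
      _ ≤ 4 * (1000 * (i + 1) * (i + 2) * (cut S U W).card) := Nat.mul_le_mul_left 4 h1
      _ ≤ 4 * (1000 * (i + 1) * (i + 2) * (ℓ * (nbr S U W).card)) := Nat.mul_le_mul_left 4 h3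
      _ = _ := by ring
  exact Nat.le_of_mul_le_mul_left h6 hℓ0

end Summit.PneNP.PneNP.Theorems.ColumnTwo
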